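import Summits.CriticalPhenomena.PercolationContinuityZ3.Theses.PercNearOneGluing
import Literature.Probability.Percolation.PercolationEvents
import HarnessLib.Audit
import Summits.CriticalPhenomena.PercolationContinuityZ3.Theorems.PercNearOneGluingNearOneGluingShorteningReduction
import Summits.CriticalPhenomena.PercolationContinuityZ3.Theorems.PercNearOneGluingNearOneGluingShorteningOfSetRelay

/-! TTRL-lite variant V2458 of stmt-CriticalPhenomena-4574

(`stub_shorteningStep` of line `kn_shortening_induction`, move `specialise+small_case`:
`n := 5` and `A.card = 3`).  Kozma–Nitzan's shortening step (arXiv:2401.12397, Conjecture 6,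
p. 34, measured against the minimiser `a₀` of the UNcontracted graph) on five vertices with three
relays, proved outright (the displayed induction hypothesis is not used).

Write `μ = prodBernoulli w`, `μ₁ = prodBernoulli (w[s(v,x) ↦ 1])`, `V = {v, x}`.  Case analysis on
the position of the glued partner `x` and of the target `b`:
* `x ∈ A`: minimality gives `μ(a₀ ↔ b) ≤ μ(x ↔ b)` and `shorteningStep_of_le_partner` applies
  (Kozma–Nitzan Lemma 3 for the decreasing event `{V ↮ a₀}`).
* `b = v` / `b = x`: `μ(a₀ ↔ b) ≤ 1 = μ(b ↔ b)`, so `shorteningStep_of_le_source` /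
  `shorteningStep_of_le_partner` apply.
* `b = a₀`: minimality at `b = a₀` forces `μ(a ↔ a₀) = 1` for every relay `a`, so the set-relay
  exchange inequality of `shorteningStep_of_setRelayExchange` reads `0 ≤ 0` (its left event lies in
  `⋃_{a ∈ A} {a ↮ a₀}`, a null set).
* otherwise `x ∉ A` and `b ∉ {v, x}`, so by counting (`|{v, x} ∪ A| = 5`) `b ∈ A ∖ {a₀}` and
  `A = {a₀, b, a₂}`.  In the set-relay exchange inequality the relays `a₀` and `b` cannot be the one
  joined to `V` (on `{a₀ ↔ b} ∩ {V ↮ a₀}`), so the relevant event is the mixed-monotone set-observer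
  event `{V ↔ a₂} ∩ {V ↮ a₀}` and Kozma–Nitzan Lemma 3 (`knLemma3Mixed_setObserver_star`, from
  van den Berg–Häggström–Kahn 2006 Thm 1.5) fed with `μ(a₀ ↔ b) ≤ μ(a₂ ↔ b)` closes it — the
  `|A| ≤ 2` template (`stub_shorteningStep_var2415`) with the idle third relay `b`.
No new definitions, no named facts. -/

namespace Summit.CriticalPhenomena.PercolationContinuityZ3.Theorems

open MeasureTheory Set Literature.Probability.LatticeModels Literature.Probability.Percolation
open scoped Classical BigOperators

/-- TTRL-lite variant V2458 of `stub_shorteningStep` (stmt-CriticalPhenomena-4574): Kozma–Nitzan's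
shortening step (Conjecture 6 of arXiv:2401.12397, against the pre-gluing minimiser `a₀`) on `Fin 5`
with `A.card = 3`.  Cases: `x ∈ A` or `b ∈ {v, x}` (`shorteningStep_of_le_partner` /
`shorteningStep_of_le_source`); `b = a₀` (all relays a.s. joined to `a₀`, the set-relay exchange
inequality is `0 ≤ 0`); else `A = {a₀, b, a₂}` by counting and the set-relay exchange inequality
(`shorteningStep_of_setRelayExchange`) is Kozma–Nitzan Lemma 3 for the mixed set-observer event
`{V ↔ a₂} ∩ {V ↮ a₀}` (`knLemma3Mixed_setObserver_star`) under `μ(a₀ ↔ b) ≤ μ(a₂ ↔ b)`. -/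
theorem stub_shorteningStep_var2458 : ∀ (w : Sym2 (Fin 5) → unitInterval) (A : Finset (Fin 5)) (b v x a₀ : Fin 5), A.card = 3 → v ∉ A → v ≠ x → w s(v, x) = 0 → a₀ ∈ A → (∀ a ∈ A, (prodBernoulli w).real (openConn a₀ b) ≤ (prodBernoulli w).real (openConn a b)) → (∀ w' : Sym2 (Fin 5) → unitInterval, (∀ e, w e = 0 → w' e = 0) → ∀ (A' : Finset (Fin 5)) (o' b' : Fin 5) (t : ℝ), (∀ a ∈ A', t ≤ (prodBernoulli w').real (openConn a b')) → (prodBernoulli w').real (⋃ a ∈ A', openConn o' a) * t ≤ (prodBernoulli w').real (openConn o' b')) → (prodBernoulli (Function.update w s(v, x) 1)).real (⋃ a ∈ A, openConn v a) * (prodBernoulli (Function.update w s(v, x) 1)).real (openConn a₀ b) ≤ (prodBernoulli (Function.update w s(v, x) 1)).real (openConn v b) := by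
  intro w A b v x a₀ hcard hvA hvx _hw0 ha₀ hmin _hIH
  -- `z ↔ z` holds everywhere, so `μ(a₀ ↔ z) ≤ μ(z ↔ z)`
  have hrefl : ∀ z : Fin 5,
      (prodBernoulli w).real (openConn a₀ z) ≤ (prodBernoulli w).real (openConn z z) := fun z =>
    measureReal_mono (fun ω _ => (SimpleGraph.Reachable.refl z : (openGraph ω).Reachable z z))
      (measure_ne_top _ _)
  -- (1) the glued partner is a relay: `μ(a₀ ↔ b) ≤ μ(x ↔ b)` by minimality
  by_cases hxA : x ∈ A
  · exact shorteningStep_of_le_partner 5 w A b v x a₀ hvx (hmin x hxA)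
  -- (2) the target is the source or its glued partner
  by_cases hbv : b = v
  · refine shorteningStep_of_le_source 5 w A b v x a₀ hvx ?_
    rw [hbv]
    exact hrefl v
  by_cases hbx : b = x
  · refine shorteningStep_of_le_partner 5 w A b v x a₀ hvx ?_
    rw [hbx]
    exact hrefl x
  -- every event is measurable on the finite configuration space
  have hmeas : ∀ S : Set (BondConfig (Fin 5)), MeasurableSet S := fun S =>
    MeasurableSet.of_discrete
  -- (3) the target is the designated relay: every relay is a.s. joined to `a₀`
  by_cases hba : b = a₀
  · refine shorteningStep_of_setRelayExchange 5 w A b v x a₀ hvx ?_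
    have hmin' : ∀ a ∈ A,
        (prodBernoulli w).real (openConn a₀ a₀) ≤ (prodBernoulli w).real (openConn a a₀) := by
      rw [hba] at hmin
      exact hmin
    have huniv : (openConn a₀ a₀ : Set (BondConfig (Fin 5))) = Set.univ :=
      Set.eq_univ_of_forall fun ω => (SimpleGraph.Reachable.refl a₀ : (openGraph ω).Reachable a₀ a₀)
    -- the left event lies in the null set `⋃_{a ∈ A} {a ↮ a₀}`
    have hsub : openConn a₀ b ∩ {ω : BondConfig (Fin 5) |
        (∃ a ∈ A, ∃ y ∈ ({v, x} : Finset (Fin 5)), (openGraph ω).Reachable a y) ∧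
          ∀ y ∈ ({v, x} : Finset (Fin 5)), ¬ (openGraph ω).Reachable a₀ y} ⊆
        ⋃ a ∈ A, (openConn a a₀)ᶜ := by
      rintro ω ⟨-, ⟨a, ha, y, hy, hay⟩, hno⟩
      refine Set.mem_iUnion₂.2 ⟨a, ha, fun haa => hno y hy ?_⟩
      exact (SimpleGraph.Reachable.symm haa).trans hay
    have hle : (prodBernoulli w).real (openConn a₀ b ∩ {ω : BondConfig (Fin 5) |
        (∃ a ∈ A, ∃ y ∈ ({v, x} : Finset (Fin 5)), (openGraph ω).Reachable a y) ∧
          ∀ y ∈ ({v, x} : Finset (Fin 5)), ¬ (openGraph ω).Reachable a₀ y}) ≤ 0 := by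
      refine (measureReal_mono hsub (measure_ne_top _ _)).trans ?_
      refine (measureReal_biUnion_finset_le _ _).trans (Finset.sum_nonpos fun a ha => ?_)
      have h1 := hmin' a ha
      rw [huniv, probReal_univ] at h1
      rw [measureReal_compl (hmeas _), probReal_univ]
      linarith
    exact hle.trans measureReal_nonneg
  -- (4) counting: `{v, x} ∪ A` exhausts `Fin 5`, so `b ∈ A`
  have hbA : b ∈ A := by
    by_contra hbA
    have hx' : x ∉ insert b A := by
      rw [Finset.mem_insert]
      rintro (h | h)
      exacts [hbx h.symm, hxA h]
    have hv' : v ∉ insert x (insert b A) := by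
      rw [Finset.mem_insert, Finset.mem_insert]
      rintro (h | h | h)
      exacts [hvx h, hbv h.symm, hvA h]
    have h5 := Finset.card_le_univ (insert v (insert x (insert b A)))
    rw [Finset.card_insert_of_notMem hv', Finset.card_insert_of_notMem hx',
      Finset.card_insert_of_notMem hbA, hcard, Fintype.card_fin] at h5
    omega
  -- the third relay: `A = {a₀, b, a₂}`
  have hcard1 : ((A.erase a₀).erase b).card = 1 := by
    have h1 := Finset.card_erase_of_mem (Finset.mem_erase.2 ⟨hba, hbA⟩ : b ∈ A.erase a₀)
    have h2 := Finset.card_erase_of_mem ha₀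
    omega
  obtain ⟨a₂, hS⟩ := Finset.card_eq_one.1 hcard1
  have ha₂S : a₂ ∈ (A.erase a₀).erase b := by
    rw [hS]
    exact Finset.mem_singleton_self a₂
  obtain ⟨-, ha₂'⟩ := Finset.mem_erase.1 ha₂S
  obtain ⟨-, ha₂⟩ := Finset.mem_erase.1 ha₂'
  have hA : ∀ a ∈ A, a ≠ a₀ → a ≠ b → a = a₂ := by
    intro a ha h0 h1
    have hmem : a ∈ (A.erase a₀).erase b := Finset.mem_erase.2 ⟨h1, Finset.mem_erase.2 ⟨h0, ha⟩⟩
    rw [hS] at hmem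
    exact Finset.mem_singleton.1 hmem
  -- (5) main case: set-relay exchange = Kozma–Nitzan Lemma 3 (mixed) for the single relay `a₂`
  refine shorteningStep_of_setRelayExchange 5 w A b v x a₀ hvx ?_
  have hL3 := knLemma3Mixed_setObserver_star 5 w a₀ a₂ b ({v, x} : Finset (Fin 5)) 0 le_rfl
    (by rw [add_zero]; exact hmin a₂ ha₂)
  refine (measureReal_mono ?_ (measure_ne_top _ _)).trans (hL3.trans ?_)
  · -- on `{a₀ ↔ b} ∩ {V ↮ a₀}` the relay joined to `V` is neither `a₀` nor `b`
    rintro ω ⟨hab, ⟨a, ha, y, hy, hay⟩, hno⟩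
    refine ⟨hab, ⟨y, hy, ?_⟩, hno⟩
    by_cases h0 : a = a₀
    · rw [h0] at hay
      exact (hno y hy hay).elim
    by_cases h1 : a = b
    · rw [h1] at hay
      exact (hno y hy ((hab : (openGraph ω).Reachable a₀ b).trans hay)).elim
    rw [hA a ha h0 h1] at hay
    exact hay
  · rw [add_zero]
    refine measureReal_mono ?_ (measure_ne_top _ _)
    rintro ω ⟨hyb, hy2, hno⟩
    exact ⟨hyb, ⟨a₂, ha₂, hy2⟩, hno⟩

end Summit.CriticalPhenomena.PercolationContinuityZ3.Theorems
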